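import Literature.NumberTheory.IwasawaTheory.Greenberg2006.CohomologyCofiniteGenerationGlobalHyp
import Literature.NumberTheory.IwasawaTheory.Greenberg2006.CohomologyCofinitelyGeneratedLocal
import HarnessLib

/-!
# Greenberg 2006, Prop. 3.2 (`prop32_cohomology_isCofinitelyGenerated`) HOLDS modulo the single
# textbook named fact NSW (8.3.20) = Harari Cor. 17.17 (`GaloisCohomology.finite_restrictedCohomology`)

Topic `NumberTheory/IwasawaTheory/Greenberg2006`; namespace
`Literature.NumberTheory.IwasawaTheory.Greenberg2006`; THEOREMS ONLY (no definition, no named fact,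
no `sorry`).

The named fact `prop32_cohomology_isCofinitelyGenerated` (`GaloisCohomologyStructure.lean`; Greenberg,
Doc. Math. 2006, Prop. 3.2: "For any `i ≥ 0`, `Hⁱ(G, 𝒟)` is a cofinitely generated `R`-module", for
`G = Gal(K_Σ/K)` and `G = G_{K_v}` at every place, `R = Λ ≅ ℤ_p⟦T₁,…,T_m⟧`) was reduced by
`prop32_of_hypF` (`CohomologyCofiniteGenerationAssembly.lean`) to print's standing finiteness
hypothesis (F) — "We will assume throughout that the cohomology groups `Hⁱ(G, α_k)` are finite … This is
so if (i) `G = G_{K_v}` … or if (ii) `G = Gal(K_Σ/K)`" (p. 358 L8–13) — for (ii) and for (i) at the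
finite places.  Both halves are now in the tree: (i) UNCONDITIONALLY (`hypF_loc`,
`CohomologyCofinitelyGeneratedLocal.lean`: `H⁰ ⊆ A`, Serre II §5.2 Prop. 14 for `H¹`, Tate's
`(2,0)`-duality for `H²`, `cd_p ≤ 2` for `n ≥ 3`), (ii) from the named fact
`GaloisCohomology.finite_restrictedCohomology` (`hFglob_of_finite_restrictedCohomology`,
`CohomologyCofiniteGenerationGlobalHyp.lean`, through `RestrictedRamificationFiniteCoefficients.lean`).
This file records the COMPOSITION:

* **`prop32_cohomology_isCofinitelyGenerated_of_finite_restrictedCohomology`** — the named fact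
  Greenberg 2006 Prop. 3.2 follows from `∀ K, GaloisCohomology.finite_restrictedCohomology K`
  (Neukirch–Schmidt–Wingberg (8.3.20) (i) = Harari Cor. 17.17 = Milne ADT I Cor. 4.15): a REFEREED
  2006 proposition leaves every consumer's list of named facts for ONE textbook theorem;
* `prop32_local_holds` — the LOCAL conjunct of the fact (every place, every degree) is a theorem
  outright (re-export of `isCofinitelyGenerated_localRep_H` at the fact's binders);
* `prop32_of_finite_restrictedCohomology_at` — the per-field form: the fact's conclusion at given
  binders `(p, K, S, Λ, 𝒟, ρ)` from `finite_restrictedCohomology K` for THAT `K` only (what a consumer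
  working over one imaginary quadratic field needs).

Print's proof is thereby formalised in full for Mathlib's continuous cohomology (width seats
bsd-line-sbc-p1-w2, -w3, -w4 of the consuming crux, 2026-08-28: long exact sequences, `λ`-dévissage,
Nakayama for Pontryagin duals, `H¹(K_S/K, finite)` finite by Hermite, local finiteness in all degrees);
the only input not proved in the tree is the global finiteness `Hⁿ(G_{K,S}, A)` finite for `n ≥ 2`
(class field theory / Poitou–Tate), carried by the textbook named fact.

## References
* R. Greenberg, *On the structure of certain Galois cohomology groups*, Doc. Math. Extra Vol.
  Coates (2006) 335–391, §3 A (p. 358 L8–13; Prop. 3.2 p. 358 L37, proof pp. 358–359), §4 p. 367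
  L33–39. [Greenberg2006]
* J. Neukirch, A. Schmidt, K. Wingberg, *Cohomology of Number Fields*, 2nd ed., (8.3.20).
  [NeukirchSchmidtWingberg2008]
* D. Harari, *Galois Cohomology and Class Field Theory* (2020), Cor. 17.17. [Harari2020]
-/

noncomputable section

open scoped Classical
open NumberField IsDedekindDomain Field IsLocalRing
open Literature.NumberTheory.GaloisRepresentations
open Literature.NumberTheory.GaloisCohomology
open Literature.NumberTheory.IwasawaTheory.Greenberg2016

namespace Literature.NumberTheory.IwasawaTheory.Greenberg2006

/-- **Greenberg 2006, Prop. 3.2 — the named fact `prop32_cohomology_isCofinitelyGenerated` HOLDS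
modulo the textbook fact NSW (8.3.20) / Harari Cor. 17.17** (`GaloisCohomology.finite_restrictedCohomology`,
for every number field): for `Λ ≅ ℤ_p⟦T₁,…,T_m⟧`, a discrete `p`-primary cofinitely generated `𝒟`
with a continuous `Λ`-linear action of `G_{K,S}` (`S ∋ v ∣ p` finite), every `Hⁱ(K_Σ/K, 𝒟)` and every
`Hⁱ(K_v, 𝒟)` (all places) is cofinitely generated.  PRINT: "Proposition 3.2. For any `i ≥ 0`,
`Hⁱ(G, D)` is a cofinitely generated `R`-module" with "(i) `G = G_{K_v}` … (ii) `G = Gal(K_Σ/K)`".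
Composition of `prop32_of_hypF` with `hFglob_of_finite_restrictedCohomology` (global (F)) and
`hypF_loc` (local (F), unconditional).
[cite: Greenberg2006, Prop. 3.2 (p. 358 L37; standing hypothesis p. 358 L8–13); §4 p. 367 L33–39]
[cite: NeukirchSchmidtWingberg2008, (8.3.20)] [cite: Harari2020, Cor. 17.17 (p. 295)] -/
theorem prop32_cohomology_isCofinitelyGenerated_of_finite_restrictedCohomology
    (hPT : ∀ (K : Type) [Field K] [NumberField K], finite_restrictedCohomology K) :
    prop32_cohomology_isCofinitelyGenerated :=
  prop32_of_hypF (hFglob_of_finite_restrictedCohomology hPT) hypF_loc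

/-- **The LOCAL conjunct of Greenberg 2006 Prop. 3.2 is a theorem outright** (no named fact): at the
binders of `prop32_cohomology_isCofinitelyGenerated`, `Hⁱ(K_v, 𝒟) = (localRep S ρ v).H i` is
cofinitely generated for EVERY place `v` (finite: `isCofinitelyGenerated_localRep_H_inr`; infinite:
`isCofinitelyGenerated_localRep_H_inl`) and every `i` — print's case "(i) `G = G_{K_v}`, where `K_v`
is the `v`-adic completion of a number field `K` at any prime `v`".
[cite: Greenberg2006, Prop. 3.2 (p. 358 L37); §3 A p. 358 L8–13; §4 p. 367 L33–39] -/
theorem prop32_local_holds :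
    ∀ (p : ℕ) [Fact p.Prime] (K : Type) [Field K] [NumberField K]
      (S : Set (HeightOneSpectrum (𝓞 K))), S.Finite →
      (∀ v : HeightOneSpectrum (𝓞 K), ((p : ℕ) : 𝓞 K) ∈ v.asIdeal → v ∈ S) →
    ∀ (Λ : Type) [CommRing Λ] [TopologicalSpace Λ] [IsTopologicalRing Λ] (mΛ : ℕ),
      Nonempty (Λ ≃+* MvPowerSeries (Fin mΛ) ℤ_[p]) →
    ∀ (D : Type) [AddCommGroup D] [Module Λ D] [TopologicalSpace D] [DiscreteTopology D]
      [ContinuousSMul Λ D] (ρ : ContinuousRep (GaloisGroupUnramifiedOutside K S) Λ D),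
      (∀ d : D, ∃ n : ℕ, (p ^ n : ℤ) • d = 0) → IsCofinitelyGenerated Λ D →
      ∀ (v : NumberField.Place K) (i : ℕ), IsCofinitelyGenerated Λ ((localRep S ρ v).H i) := by
  intro p _ K _ _ S _ _ Λ _ _ _ mΛ hΛ D _ _ _ _ _ ρ _ hD v i
  obtain ⟨e⟩ := hΛ
  haveI : IsLocalRing Λ := isLocalRing_of_ringEquiv_mvPowerSeries e
  exact isCofinitelyGenerated_localRep_H S ρ e hD v i

/-- **Per-field form** (what a consumer over ONE number field needs): the conclusion of
`prop32_cohomology_isCofinitelyGenerated` at given binders `(p, K, S, Λ, 𝒟, ρ)` from the textbook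
fact `finite_restrictedCohomology K` for that `K` alone — global `Hⁱ(K_Σ/K, 𝒟)` via
`isCofinitelyGenerated_H_of_finiteCoefficients` + `hypothesisF_galoisGroupUnramifiedOutside`, local
clause unconditional. [cite: Greenberg2006, Prop. 3.2 (p. 358 L37); §3 A p. 358 L8–13]
[cite: Harari2020, Cor. 17.17 (p. 295)] -/
theorem prop32_of_finite_restrictedCohomology_at
    {K : Type} [Field K] [NumberField K] (hK : finite_restrictedCohomology K)
    {p : ℕ} [Fact p.Prime] (S : Set (HeightOneSpectrum (𝓞 K))) (hS : S.Finite)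
    (hSp : ∀ v : HeightOneSpectrum (𝓞 K), ((p : ℕ) : 𝓞 K) ∈ v.asIdeal → v ∈ S)
    {Λ : Type} [CommRing Λ] [TopologicalSpace Λ] [IsTopologicalRing Λ] {mΛ : ℕ}
    (e : Λ ≃+* MvPowerSeries (Fin mΛ) ℤ_[p])
    {D : Type} [AddCommGroup D] [Module Λ D] [TopologicalSpace D] [DiscreteTopology D]
    [ContinuousSMul Λ D] (ρ : ContinuousRep (GaloisGroupUnramifiedOutside K S) Λ D)
    (hD : IsCofinitelyGenerated Λ D) :
    (∀ i : ℕ, IsCofinitelyGenerated Λ (ρ.H i)) ∧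
      ∀ (v : NumberField.Place K) (i : ℕ), IsCofinitelyGenerated Λ ((localRep S ρ v).H i) := by
  haveI : IsLocalRing Λ := isLocalRing_of_ringEquiv_mvPowerSeries e
  refine ⟨fun i => ?_, fun v i => isCofinitelyGenerated_localRep_H S ρ e hD v i⟩
  refine isCofinitelyGenerated_H_of_finiteCoefficients e (fun A _ _ _ _ _ _ τ hkill _ n => ?_) ρ hD i
  exact hypothesisF_galoisGroupUnramifiedOutside S hK hS p hSp (maximalIdeal Λ)
    (natCast_mem_maximalIdeal_of_ringEquiv_mvPowerSeries e) A τ hkill n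

end Literature.NumberTheory.IwasawaTheory.Greenberg2006

end
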